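import Mathlib
import Summits.ResolutionOfSingularities.ResolutionOfSingularities.Theorems.RadicialJungCleanModelsCleanProp44LeafOrderDivision
import Literature.AlgebraicGeometry.Resolution.HypersurfaceTransform
import Literature.AlgebraicGeometry.Resolution.MarkedIdealsLemmas
import Literature.AlgebraicGeometry.Resolution.StalkIdealLemmas
import HarnessLib

/-!
# Route `RadicialJung`, crux `CleanModels` (stmt-ResolutionOfSingularities-15917), line `Sketch` rev 35, stub 6 `stub_cleanProp44` (X44c):
# THE WEIGHTED LEAF ORDER OF THE CONTROLLED TRANSFORM — ✓ `…LeafOrderDivision` read on the tree's `controlledTransform` (scheme side of census (iii-3) (S))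

Seat decomp-res-hand-2 g20 (structural hand).  ✓ `mem_sum_of_pow_mul_mem_map` (`…CleanProp44LeafOrderDivision.lean`) is stated for an abstract chart map `ψ` with
`ψ(𝔪)A ⊆ (v)`; here it is instantiated on the STALKS of a morphism `π : X′ → X` and the tree's CONTROLLED TRANSFORM `controlledTransform π C J μ = (π^*J : (π^*C)^μ)`
(`Literature/…/MarkedIdeals.lean`), at a point `z ∈ X′` where the centre ideal becomes principal, `C_{π z}·𝒪_{X′,z} = (e′)` (`e′` a non-zero-divisor — for a
blowing up, the exceptional parameter).  No `IsBlowup` hypothesis is needed: only `stalkIdeal_colon` / `stalkIdeal_pow` / `stalkIdeal_comap_eq_map_stalkMap`.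

* `stalkIdeal_controlledTransform_le_leafSum` — for `t ∈ 𝒪_{X,πz}` with `π♯t = e′·t₁` (the strict transform of the leaf `V(t) ⊇` centre through `z`) and
  `J_{πz} ⊆ Σ_{e≤μ} (t^e)·C_{πz}^{n_e}` (`μ ≤ e + n_e`; «`δ(πz, V(t)) ≥ …`» relative to the CENTRE ideal — for a point centre `C_{πz} = 𝔪_{πz}` this is the
  def-free `δ ≥ d` of memo 4e §2.5): `(controlledTransform π C J μ)_z ⊆ Σ_{e≤μ} (t₁^e)·(e′)^{e+n_e−μ}`.
* `stalkIdeal_controlledTransform_le_span_pair_pow` / `le_idealOrder_controlledTransform_of_weight` — integer weight `d ≥ 2`: `(controlledTransform)_z ⊆ (t₁, e′)^μ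
  ⊆ 𝔪_z^μ`, so `μ ≤ ord_z(controlledTransform)`: every point of the strict transform of the leaf over the centre is NEAR («`δ ≥ 2` ⟹ `Z₀ = E ∩ L̃` near»).

Honest framing: OURS (instantiation); the identification of the successive centres `Z_j` and of `Γ″` remains (census (S)); nothing here proves X44c, any case of
`CleanModels`, or resolution of singularities in characteristic `p`. [cite: BierstoneGrigorievMilmanWlodarczyk2011, §3.2] [cite: CossartPiltant2008, Lemma 4.3 (4)–(5)]
[cite: CossartJannsenSaito2020, Lemma 7.5]
-/

noncomputable section

set_option linter.dupNamespace false -- mandated namespace of this single-conjunct summit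

open CategoryTheory AlgebraicGeometry TopologicalSpace IsLocalRing
open Literature.AlgebraicGeometry.Resolution

namespace Summit.ResolutionOfSingularities.ResolutionOfSingularities.Theorems.RadicialJung.CleanModels

universe u

variable {X X' : Scheme.{u}} [IsLocallyNoetherian X'] (π : X' ⟶ X) (C : X.IdealSheafData) (z : X')

/-- **Membership in the stalk of the controlled transform**: with `C_{πz}𝒪_{X′,z} = (e′)`, `x ∈ (controlledTransform π C J μ)_z` gives `e′^μ·x ∈ J_{πz}𝒪_{X′,z}`.
[cite: BierstoneGrigorievMilmanWlodarczyk2011, §3.2] -/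
theorem pow_mul_mem_map_of_mem_stalkIdeal_controlledTransform {e' : X'.presheaf.stalk z}
    (he' : Ideal.span {e'} = (stalkIdeal C (π z)).map (π.stalkMap z).hom) (J : X.IdealSheafData) (μ : ℕ) {x : X'.presheaf.stalk z}
    (hx : x ∈ stalkIdeal (controlledTransform π C J μ) z) : e' ^ μ * x ∈ (stalkIdeal J (π z)).map (π.stalkMap z).hom := by
  rw [controlledTransform, stalkIdeal_colon, stalkIdeal_pow, stalkIdeal_comap_eq_map_stalkMap, stalkIdeal_comap_eq_map_stalkMap, ← he'] at hx
  have h1 := Submodule.mem_colon.mp hx (e' ^ μ) (by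
    rw [Ideal.span_singleton_pow]; exact Ideal.mem_span_singleton_self _)
  rw [smul_eq_mul, mul_comm] at h1
  exact h1

/-- **THE WEIGHTED LEAF ORDER OF THE CONTROLLED TRANSFORM** (✓ `mem_sum_of_pow_mul_mem_map` on stalks): `C_{πz}𝒪_{X′,z} = (e′)` with `e′` a non-zero-divisor,
`π♯t = e′·t₁`, `J_{πz} ⊆ Σ_{e≤μ} (t^e)·C_{πz}^{n_e}` with `μ ≤ e + n_e` ⟹ `(controlledTransform π C J μ)_z ⊆ Σ_{e≤μ} (t₁^e)·(e′)^{e + n_e − μ}`.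
[cite: CossartJannsenSaito2020, Lemma 7.5] [cite: CossartPiltant2008, Prop. 4.4 (proof, p. 11)] -/
theorem stalkIdeal_controlledTransform_le_leafSum {e' : X'.presheaf.stalk z}
    (he' : Ideal.span {e'} = (stalkIdeal C (π z)).map (π.stalkMap z).hom) (he'0 : e' ∈ nonZeroDivisors (X'.presheaf.stalk z))
    {t : X.presheaf.stalk (π z)} {t₁ : X'.presheaf.stalk z} (ht : (π.stalkMap z).hom t = e' * t₁) (μ : ℕ) (n : ℕ → ℕ)
    (hn : ∀ e ≤ μ, μ ≤ e + n e) {J : X.IdealSheafData}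
    (hJ : stalkIdeal J (π z) ≤ ∑ e ∈ Finset.range (μ + 1), Ideal.span {t ^ e} * stalkIdeal C (π z) ^ n e) :
    stalkIdeal (controlledTransform π C J μ) z ≤
      ∑ e ∈ Finset.range (μ + 1), Ideal.span {t₁ ^ e} * Ideal.span {e'} ^ (e + n e - μ) := by
  intro x hx
  exact mem_sum_of_pow_mul_mem_map (π.stalkMap z).hom (stalkIdeal C (π z)) he'0 (by rw [he']) ht μ n hn hJ
    (pow_mul_mem_map_of_mem_stalkIdeal_controlledTransform π C z he' J μ hx)

/-- **Integer weight `d ≥ 2`: the strict transform of the leaf over the centre lies in the order-`μ` locus** — `(controlledTransform)_z ⊆ (t₁, e′)^μ`.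
[cite: CossartPiltant2008, Lemma 4.3 (4)–(5)] -/
theorem stalkIdeal_controlledTransform_le_span_pair_pow {e' : X'.presheaf.stalk z}
    (he' : Ideal.span {e'} = (stalkIdeal C (π z)).map (π.stalkMap z).hom) (he'0 : e' ∈ nonZeroDivisors (X'.presheaf.stalk z))
    {t : X.presheaf.stalk (π z)} {t₁ : X'.presheaf.stalk z} (ht : (π.stalkMap z).hom t = e' * t₁) (μ d : ℕ) (hd : 2 ≤ d) {J : X.IdealSheafData}
    (hJ : stalkIdeal J (π z) ≤ ∑ e ∈ Finset.range (μ + 1), Ideal.span {t ^ e} * stalkIdeal C (π z) ^ ((μ - e) * d)) :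
    stalkIdeal (controlledTransform π C J μ) z ≤ Ideal.span ({t₁, e'} : Set (X'.presheaf.stalk z)) ^ μ := fun _ hx =>
  pow_mul_mem_map_le_span_pair_pow (π.stalkMap z).hom (stalkIdeal C (π z)) he'0 (by rw [he']) ht μ d hd hJ
    (pow_mul_mem_map_of_mem_stalkIdeal_controlledTransform π C z he' J μ hx)

/-- **Hence such a point is NEAR**: if moreover `t₁, e′ ∈ 𝔪_z` (`z` lies on the strict transform of the leaf and on the exceptional divisor) then
`μ ≤ ord_z (controlledTransform π C J μ)` (memo 4e §2.5 «`Z_j` is near ⟺ `δ ≥ j + 2`», the case `j = 0`, direction ⟸, pointwise). [cite: CossartPiltant2008, Lemma 4.3 (4)–(5)] -/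
theorem le_idealOrder_controlledTransform_of_weight {e' : X'.presheaf.stalk z}
    (he' : Ideal.span {e'} = (stalkIdeal C (π z)).map (π.stalkMap z).hom) (he'0 : e' ∈ nonZeroDivisors (X'.presheaf.stalk z))
    (he'm : e' ∈ maximalIdeal (X'.presheaf.stalk z)) {t : X.presheaf.stalk (π z)} {t₁ : X'.presheaf.stalk z}
    (ht : (π.stalkMap z).hom t = e' * t₁) (ht₁m : t₁ ∈ maximalIdeal (X'.presheaf.stalk z)) (μ d : ℕ) (hd : 2 ≤ d) {J : X.IdealSheafData}
    (hJ : stalkIdeal J (π z) ≤ ∑ e ∈ Finset.range (μ + 1), Ideal.span {t ^ e} * stalkIdeal C (π z) ^ ((μ - e) * d)) :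
    (μ : ℕ∞) ≤ idealOrder (controlledTransform π C J μ) z := by
  rw [le_idealOrder_iff]
  refine (stalkIdeal_controlledTransform_le_span_pair_pow π C z he' he'0 ht μ d hd hJ).trans (Ideal.pow_right_mono ?_ μ)
  rw [Ideal.span_le, Set.insert_subset_iff, Set.singleton_subset_iff]
  exact ⟨ht₁m, he'm⟩

end Summit.ResolutionOfSingularities.ResolutionOfSingularities.Theorems.RadicialJung.CleanModels

end
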